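import Mathlib
import Summits.HubbardSuperconductivity.HubbardSuperconductivity.Theorems.BalabanIRBirBdGPhaseCoercivityLyapunovHat
import Summits.HubbardSuperconductivity.HubbardSuperconductivity.Theorems.BalabanIRBirBdGPhaseCoercivityModes

/-!
# Route BalabanIR — crux 4R `BirGappedPhaseReductionR` (item `stmt-HubbardSuperconductivity-14846`):
# block-London coercivity I — the non-local XY functional of `lyap_core` in Fourier modes

The Lyapunov deficit bound of crux 3 (`BirBdG.lyap_core`, file `…BdGPhaseCoercivityLyapunovCore`)
controls, for every phase texture `u = e^{iθ}` of the `d+id` BdG reference, the NON-LOCAL XY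
functional `Σ_{x,y} |F_{xy}|² |u_y - u_x|²` with the translation-invariant kernel
`F = N⁻¹ Wᴴ diag(f) W` (`f = Δ/E` the anomalous amplitude symbol, `W_{kx} = conj χ_k(x)` the plane
waves, `N = L^d`).  This file puts that functional in Fourier modes:

* `sum_normSq_eq_modes`, `sum_normSq_sub_shift_eq_modes`: Plancherel and the shifted-difference
  functional `Σ_x |u_x - u_{x+e}|² = N⁻¹ Σ_q |û(q)|² |1 - χ_q(e)|²`, `û(q) = Σ_x u_x χ_q(x)`;
* `kernelFunctional_eq_modes`: `Σ_{x,y} |F_{xy}|² |u_y - u_x|² = N⁻² Σ_q |û(q)|² Σ_k |f_k - f_{k+q}|²`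
  — the functional is diagonal in the texture momentum with the manifestly nonnegative symbol
  `S(q) = N⁻¹ Σ_k |f_k - f_{k+q}|²` (the "structure factor" of the symbol `f`);
* `kernelFunctional_ge_of_symbol_le`: consequently it dominates EVERY translation-invariant
  quadratic functional `N⁻¹ Σ_q w(q) |û(q)|²` whose symbol satisfies `w(q) ≤ S(q)`.

With `w` the symbol of the lattice XY functional this is the shape of crux 3; with `w` the symbol of
the block (London) misalignment functional (file `…BlockLondonJensen`) it is the first stub of the
card `london-block-coercivity` of this crux (file `…BlockLondon`).  Harmonic analysis on the
discrete torus only (Friedli–Velenik 2017, §10.4); no definition is introduced.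
-/

noncomputable section

namespace Summit.HubbardSuperconductivity.HubbardSuperconductivity.Theorems

namespace BirBdG

open Matrix Finset Literature.Probability.LatticeModels
open scoped ComplexConjugate ComplexOrder

variable {d L : ℕ} [NeZero L]

/-- **Plancherel on the discrete torus**: `Σ_x |u_x|² = N⁻¹ Σ_q |û(q)|²`, `û(q) = Σ_x u_x χ_q(x)`,
`N = L^d`. [cite: FriedliVelenik2017, §10.4] -/
theorem sum_normSq_eq_modes (u : TorusSite d L → ℂ) :
    ∑ x, ‖u x‖ ^ 2 = ((L ^ d : ℕ) : ℝ)⁻¹ * ∑ q, ‖∑ x, u x * torusChar q x‖ ^ 2 := by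
  have hN : ((L ^ d : ℕ) : ℝ) ≠ 0 := by exact_mod_cast pow_ne_zero d (NeZero.ne L)
  rw [BirSliceXY.sum_norm_sq_sum_mul_torusChar u]
  push_cast
  rw [← mul_assoc, inv_mul_cancel₀ (by exact_mod_cast hN), one_mul]

/-- `|1 - χ|² = 2 - 2 Re χ` for a unimodular `χ`. [folklore] -/
theorem normSq_one_sub_torusChar (q e : TorusSite d L) :
    ‖1 - torusChar q e‖ ^ 2 = 2 - 2 * (torusChar q e).re := by
  rw [← Complex.normSq_eq_norm_sq, Complex.normSq_sub, Complex.normSq_one,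
    Complex.normSq_eq_norm_sq, norm_torusChar, one_pow, one_mul, Complex.conj_re]
  ring

/-- **The shifted-difference functional in modes**:
`Σ_x |u_x - u_{x+e}|² = N⁻¹ Σ_q |û(q)|² |1 - χ_q(e)|²`. [cite: FriedliVelenik2017, §10.4] -/
theorem sum_normSq_sub_shift_eq_modes (u : TorusSite d L → ℂ) (e : TorusSite d L) :
    ∑ x, ‖u x - u (x + e)‖ ^ 2 =
      ((L ^ d : ℕ) : ℝ)⁻¹ * ∑ q, ‖∑ x, u x * torusChar q x‖ ^ 2 * ‖1 - torusChar q e‖ ^ 2 := by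
  -- `|a - b|² = |a|² + |b|² - 2 Re (a conj b)` pointwise
  have hpt : ∀ x, ‖u x - u (x + e)‖ ^ 2 =
      ‖u x‖ ^ 2 + ‖u (x + e)‖ ^ 2 - 2 * (u x * conj (u (x + e))).re := by
    intro x
    rw [← Complex.normSq_eq_norm_sq, Complex.normSq_sub, Complex.normSq_eq_norm_sq,
      Complex.normSq_eq_norm_sq]
  simp_rw [hpt]
  rw [Finset.sum_sub_distrib, Finset.sum_add_distrib]
  -- the shifted sum of squares is the unshifted one
  have hshift : ∑ x, ‖u (x + e)‖ ^ 2 = ∑ x, ‖u x‖ ^ 2 :=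
    Fintype.sum_equiv (Equiv.addRight e) _ _ (fun x => rfl)
  rw [hshift, sum_normSq_eq_modes u, ← Finset.mul_sum, ← Complex.re_sum, sum_mul_conj_shift_eq u e]
  -- real part of the Wiener–Khinchin sum
  have hc : (((L ^ d : ℕ) : ℂ))⁻¹ = ((((L ^ d : ℕ) : ℝ)⁻¹ : ℝ) : ℂ) := by push_cast; rfl
  rw [hc, Complex.re_ofReal_mul, Complex.re_sum]
  simp_rw [Complex.re_ofReal_mul, normSq_one_sub_torusChar]
  rw [Finset.mul_sum, Finset.mul_sum, Finset.mul_sum, ← Finset.sum_add_distrib, Finset.mul_sum,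
    ← Finset.sum_sub_distrib]
  refine Finset.sum_congr rfl fun q _ => ?_
  ring

/-- **The non-local XY functional of `lyap_core` in modes.** For every symbol `f` and every
complex field `u` on `(ℤ/L)^d`, with `F = N⁻¹ Wᴴ diag(f) W` (`W_{kx} = conj χ_k(x)`, `N = L^d`):
`Σ_{x,y} |F_{xy}|² |u_y - u_x|² = N⁻² Σ_q |û(q)|² Σ_k |f_k - f_{k+q}|²`.
(Plane-wave conjugation of the commutator `[F, diag u]`: its Hilbert–Schmidt norm is preserved and
its momentum entries are `N⁻¹ û(k' - k) (f_k - f_{k'})`.) [cite: FriedliVelenik2017, §10.4] -/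
theorem kernelFunctional_eq_modes (f u : TorusSite d L → ℂ) :
    ∑ x : TorusSite d L, ∑ y : TorusSite d L,
        ‖(((L ^ d : ℕ) : ℂ)⁻¹ • ((Matrix.of fun k x : TorusSite d L => conj (torusChar k x))ᴴ *
            Matrix.diagonal f * Matrix.of (fun k x : TorusSite d L => conj (torusChar k x)))) x y‖ ^ 2 *
          ‖u y - u x‖ ^ 2 =
      (((L ^ d : ℕ) : ℝ)⁻¹) ^ 2 *
        ∑ q : TorusSite d L, ‖∑ x, u x * torusChar q x‖ ^ 2 * ∑ k, ‖f k - f (k + q)‖ ^ 2 := by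
  have hN : (L ^ d : ℕ) ≠ 0 := pow_ne_zero d (NeZero.ne L)
  have h1 := planeWave_conjTranspose_mul_self (d := d) (L := L)
  have h2 := planeWave_mul_conjTranspose_self (d := d) (L := L)
  set W : Matrix (TorusSite d L) (TorusSite d L) ℂ :=
    Matrix.of (fun k x : TorusSite d L => conj (torusChar k x)) with hW
  set Fp : Matrix (TorusSite d L) (TorusSite d L) ℂ :=
    ((L ^ d : ℕ) : ℂ)⁻¹ • (Wᴴ * Matrix.diagonal f * W) with hFp
  set Uh : Matrix (TorusSite d L) (TorusSite d L) ℂ :=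
    ((L ^ d : ℕ) : ℂ)⁻¹ • (W * Matrix.diagonal u * Wᴴ) with hUhdef
  have hUh : ∀ k k', Uh k k' = ((L ^ d : ℕ) : ℂ)⁻¹ * ∑ x, u x * torusChar (k' - k) x := by
    intro k k'
    rw [hUhdef, hW, hat_diagonal_apply]
  have hatF : ((L ^ d : ℕ) : ℂ)⁻¹ • (W * Fp * Wᴴ) = Matrix.diagonal f := hat_unhat hN h2 _
  have hcomm : ((L ^ d : ℕ) : ℂ)⁻¹ • (W * (Fp * Matrix.diagonal u - Matrix.diagonal u * Fp) * Wᴴ) =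
      Matrix.diagonal f * Uh - Uh * Matrix.diagonal f := by
    rw [Matrix.mul_sub, Matrix.sub_mul, smul_sub, ← hat_mul hN h1, ← hat_mul hN h1, hatF]
  have hHS := lyap_sum_normSq_hat hN h1 (Fp * Matrix.diagonal u - Matrix.diagonal u * Fp)
  rw [hcomm] at hHS
  have lhs_entry : ∀ k k', ‖(Matrix.diagonal f * Uh - Uh * Matrix.diagonal f) k k'‖ ^ 2 =
      ‖Uh k k'‖ ^ 2 * ‖f k - f k'‖ ^ 2 := by
    intro k k'
    rw [Matrix.sub_apply, Matrix.diagonal_mul, Matrix.mul_diagonal,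
      show f k * Uh k k' - Uh k k' * f k' = Uh k k' * (f k - f k') by ring, norm_mul, mul_pow]
  have rhs_entry : ∀ x y, ‖(Fp * Matrix.diagonal u - Matrix.diagonal u * Fp) x y‖ ^ 2 =
      ‖Fp x y‖ ^ 2 * ‖u y - u x‖ ^ 2 := by
    intro x y
    rw [Matrix.sub_apply, Matrix.mul_diagonal, Matrix.diagonal_mul,
      show Fp x y * u y - u x * Fp x y = Fp x y * (u y - u x) by ring, norm_mul, mul_pow]
  simp_rw [lhs_entry, rhs_entry] at hHS
  rw [← hHS]
  -- `|Û_{kk'}|² = N⁻² |û(k' - k)|²`, then re-index `k' = k + q`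
  have hUhn : ∀ k k', ‖Uh k k'‖ ^ 2 =
      (((L ^ d : ℕ) : ℝ)⁻¹) ^ 2 * ‖∑ x, u x * torusChar (k' - k) x‖ ^ 2 := by
    intro k k'
    rw [hUh, norm_mul, mul_pow, norm_inv, Complex.norm_natCast, inv_pow]
  simp_rw [hUhn]
  have hre : ∀ k : TorusSite d L,
      ∑ k', (((L ^ d : ℕ) : ℝ)⁻¹) ^ 2 * ‖∑ x, u x * torusChar (k' - k) x‖ ^ 2 * ‖f k - f k'‖ ^ 2 =
        ∑ q, (((L ^ d : ℕ) : ℝ)⁻¹) ^ 2 * ‖∑ x, u x * torusChar q x‖ ^ 2 * ‖f k - f (k + q)‖ ^ 2 := by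
    intro k
    refine (Fintype.sum_equiv (Equiv.addLeft k) _ _ (fun q => ?_)).symm
    simp only [Equiv.coe_addLeft, add_sub_cancel_left]
  simp_rw [hre]
  rw [Finset.sum_comm, Finset.mul_sum]
  refine Finset.sum_congr rfl fun q _ => ?_
  rw [Finset.mul_sum, Finset.mul_sum]
  refine Finset.sum_congr rfl fun k _ => ?_
  ring

/-- **Domination of translation-invariant functionals by the symbol.** If a real weight `w` on the
dual torus satisfies `w(q) ≤ N⁻¹ Σ_k |f_k - f_{k+q}|²` for every `q`, then for every field `u`,
`N⁻¹ Σ_q w(q) |û(q)|² ≤ Σ_{x,y} |F_{xy}|² |u_y - u_x|²` (`F = N⁻¹ Wᴴ diag(f) W`). [folklore] -/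
theorem kernelFunctional_ge_of_symbol_le : ∀ {d L : ℕ} [NeZero L] (f u : Literature.Probability.LatticeModels.TorusSite d L → ℂ) (w : Literature.Probability.LatticeModels.TorusSite d L → ℝ), (∀ q, w q ≤ ((L ^ d : ℕ) : ℝ)⁻¹ * ∑ k, ‖f k - f (k + q)‖ ^ 2) → ((L ^ d : ℕ) : ℝ)⁻¹ * ∑ q : Literature.Probability.LatticeModels.TorusSite d L, ‖∑ x, u x * Literature.Probability.LatticeModels.torusChar q x‖ ^ 2 * w q ≤ ∑ x : Literature.Probability.LatticeModels.TorusSite d L, ∑ y : Literature.Probability.LatticeModels.TorusSite d L, ‖(((L ^ d : ℕ) : ℂ)⁻¹ • (Matrix.conjTranspose (Matrix.of fun k x : Literature.Probability.LatticeModels.TorusSite d L => (starRingEnd ℂ) (Literature.Probability.LatticeModels.torusChar k x)) * Matrix.diagonal f * Matrix.of (fun k x : Literature.Probability.LatticeModels.TorusSite d L => (starRingEnd ℂ) (Literature.Probability.LatticeModels.torusChar k x)))) x y‖ ^ 2 * ‖u y - u x‖ ^ 2 := by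
  intro d L _ f u w hw
  rw [kernelFunctional_eq_modes f u]
  have hR : (((L ^ d : ℕ) : ℝ)⁻¹) ^ 2 *
      ∑ q : TorusSite d L, ‖∑ x, u x * torusChar q x‖ ^ 2 * ∑ k, ‖f k - f (k + q)‖ ^ 2 =
      ((L ^ d : ℕ) : ℝ)⁻¹ * ∑ q : TorusSite d L, ‖∑ x, u x * torusChar q x‖ ^ 2 *
        (((L ^ d : ℕ) : ℝ)⁻¹ * ∑ k, ‖f k - f (k + q)‖ ^ 2) := by
    rw [Finset.mul_sum, Finset.mul_sum]
    refine Finset.sum_congr rfl fun q _ => ?_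
    ring
  rw [hR]
  gcongr with q _
  exact hw q

end BirBdG

end Summit.HubbardSuperconductivity.HubbardSuperconductivity.Theorems

end
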